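import Mathlib
import Summits.RiemannHypothesis.RiemannHypothesis.Theorems.WeilFormatCSchurStepDiag
import HarnessLib

/-!
# Format C: soundness of the two-level certificate for ALL truncations (`∀ N`)

Route context: Fourier–Galerkin / Schur-complement certificates of Weil positivity on a window ("format C";
cell memo `run/shared/lean/pub/rh-explicit/rh-explicit-weil-10/FORMATC-DESIGN.md` §1 (c2)–(c4), §4.10; supporting
stmt-RiemannHypothesis-0098).  After weil-2's sector split (`WeilFormatCSectorSplit.lean`) and weil-3's dictionary
(`WeilFormatCWindowGram.lean`: `weilPositivityOn_of_real_gram_psd`), a rung `WeilPositivityOn a` follows from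
`∀ N, ∀ y : ℕ → ℝ, 0 ≤ Σ_{n,m<N} y_n y_m M(n,m)` for the two real symmetric SECTOR kernels `M : ℕ → ℕ → ℝ` of Yoshida's
matrix `gramCoeff a`.  A format-C certificate is ONE finite object per sector; THIS FILE is the theorem that it implies the
statement for EVERY `N` — the `∀ N` quantifier named as risk 3 in weil-3's GO/NO-GO input — from exactly three
hypotheses, which are therefore the Lean signatures the remaining analysis layer (L-C3a/b) must deliver:

* **block certificate** `hS`: `(M|_{Fin B} − U).PosSemidef` for a real `B × B` matrix `U` (kernel-decided on rational
  data by the tree's PSD checkers; `B = M₁ + 1` modes `0..M₁` in the even sector, `B = M₁` in the odd one);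
* **far diagonal bound** `hfar` (L-C3a, `WeilFormatCFarBlockAssembly.farBlock_ge_dhat` shape): on every truncation
  `B ≤ n, m < N` of the far modes, `Σ_n d̂_n y_n² ≤ Σ_{n,m} y_n M(n,m) y_m`, with `d̂ > 0` there;
* **coupling majorant** `hU` (L-C3b): for every truncation and every block vector `x`,
  `Σ_{B≤m<N} (Σ_i M(i,m) x_i)²/d̂_m ≤ xᵀUx` — met by exact columns on `[B, B₃)` plus the structured tail majorant
  `WeilFormatC.tailMajorant` (`WeilFormatCTailMajorant.lean`) beyond, via `sum_sq_div_le_of_split`; see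
  `sum_range_mul_mul_nonneg_of_certificate_split` below.

Main results (namespace `…Theorems.WeilFormatC`):

* `sum_range_mul_mul_eq_block_add_coupling_add_far` — the bookkeeping identity
  `Σ_{n,m<N} y_n y_m M(n,m) = xᵀGx + 2 Σ_{B≤m<N} c_m y_m + Σ_{B≤n,m<N} y_n M(n,m) y_m` (`x = y|_{Fin B}`, `G = M|_{Fin B}`,
  `c_m = Σ_{i<B} M(i,m) x_i`), `B ≤ N`, `M` symmetric;
* `sum_range_mul_mul_nonneg_of_certificate` — **the soundness theorem**: the three hypotheses give
  `0 ≤ Σ_{n,m<N} y_n y_m M(n,m)` for every `N` and every real `y`;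
* `sum_range_mul_mul_nonneg_of_certificate_split` — the same with `U = U₁ + U₂`, `U₁` majorising the columns on
  `[B, B₃)` and `U₂` the tail `[B₃, N)` for every `N`.

Pure finite-dimensional real algebra (the Schur step is `WeilFormatC.schurStepDiag_posSemidef`); standard axioms only.
Nothing Weil-specific is defined here; no RH claim.
-/

-- `Summit.RiemannHypothesis.RiemannHypothesis.…` is the layout-mandated namespace (summit = problem name).
set_option linter.dupNamespace false

namespace Summit.RiemannHypothesis.RiemannHypothesis.Theorems.WeilFormatC

open Matrix Finset

/-! Notation used in the docstrings: the dense block is `G = Matrix.of (fun i j : Fin B ↦ M i j)` (modes `0, …, B−1`),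
the block vector is `x = (y_i)_{i<B}`, and the coupling coefficient of a far mode `m` is `c_m(x) = Σ_{i<B} M(i,m) x_i`
(all written out in the statements; no new definitions). -/

/-- The block quadratic form `xᵀGx` is the double sum over `range B`. -/
theorem dotProduct_block_mulVec (M : ℕ → ℕ → ℝ) (B : ℕ) (y : ℕ → ℝ) :
    (fun i : Fin B ↦ y i) ⬝ᵥ (Matrix.of fun i j : Fin B ↦ M i j) *ᵥ (fun i : Fin B ↦ y i)
      = ∑ n ∈ range B, ∑ m ∈ range B, y n * y m * M n m := by
  simp only [dotProduct, mulVec, Matrix.of_apply, Finset.mul_sum]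
  rw [Fin.sum_univ_eq_sum_range (fun n ↦ ∑ j : Fin B, y n * (M n j * y j)) B]
  refine Finset.sum_congr rfl fun n _ ↦ ?_
  rw [Fin.sum_univ_eq_sum_range (fun m ↦ y n * (M n m * y m)) B]
  refine Finset.sum_congr rfl fun m _ ↦ by ring

/-- `range N = range B ∪ Ico B N` for `B ≤ N`, disjointly. -/
theorem range_eq_range_union_Ico {B N : ℕ} (h : B ≤ N) : range N = range B ∪ Ico B N := by
  rw [Finset.range_eq_Ico, Finset.range_eq_Ico, Finset.Ico_union_Ico_eq_Ico (Nat.zero_le B) h]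

/-- `range B` and `Ico B N` are disjoint. -/
theorem disjoint_range_Ico (B N : ℕ) : Disjoint (range B) (Ico B N) := by
  rw [Finset.range_eq_Ico]
  exact Finset.Ico_disjoint_Ico_consecutive 0 B N

/-- **Bookkeeping identity.**  For a symmetric kernel `M` and `B ≤ N`:
`Σ_{n,m<N} y_n y_m M(n,m) = xᵀGx + 2 Σ_{B≤m<N} c_m y_m + Σ_{B≤n,m<N} y_n M(n,m) y_m` with `x = y|_{Fin B}`,
`G = (Matrix.of fun i j : Fin B ↦ M i j)`, `c_m = (∑ i : Fin B, M i m * x i)`. -/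
theorem sum_range_mul_mul_eq_block_add_coupling_add_far (M : ℕ → ℕ → ℝ) (hsymm : ∀ n m, M n m = M m n)
    {B N : ℕ} (hBN : B ≤ N) (y : ℕ → ℝ) :
    ∑ n ∈ range N, ∑ m ∈ range N, y n * y m * M n m
      = (fun i : Fin B ↦ y i) ⬝ᵥ (Matrix.of fun i j : Fin B ↦ M i j) *ᵥ (fun i : Fin B ↦ y i)
        + 2 * ∑ m ∈ Ico B N, (∑ i : Fin B, M i m * y i) * y m
        + ∑ n ∈ Ico B N, ∑ m ∈ Ico B N, y n * M n m * y m := by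
  have hd := disjoint_range_Ico B N
  rw [range_eq_range_union_Ico hBN, Finset.sum_union hd]
  simp only [Finset.sum_union hd]
  rw [Finset.sum_add_distrib, Finset.sum_add_distrib]
  -- the four pieces
  have hBB : ∑ n ∈ range B, ∑ m ∈ range B, y n * y m * M n m
      = (fun i : Fin B ↦ y i) ⬝ᵥ (Matrix.of fun i j : Fin B ↦ M i j) *ᵥ (fun i : Fin B ↦ y i) :=
    (dotProduct_block_mulVec M B y).symm
  have hBs : ∑ n ∈ range B, ∑ m ∈ Ico B N, y n * y m * M n m
      = ∑ m ∈ Ico B N, (∑ i : Fin B, M i m * y i) * y m := by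
    rw [Finset.sum_comm]
    refine Finset.sum_congr rfl fun m _ ↦ ?_
    rw [Fin.sum_univ_eq_sum_range (fun i ↦ M i m * y i) B, Finset.sum_mul]
    refine Finset.sum_congr rfl fun n _ ↦ by ring
  have hsB : ∑ n ∈ Ico B N, ∑ m ∈ range B, y n * y m * M n m
      = ∑ m ∈ Ico B N, (∑ i : Fin B, M i m * y i) * y m := by
    refine Finset.sum_congr rfl fun n _ ↦ ?_
    rw [Fin.sum_univ_eq_sum_range (fun i ↦ M i n * y i) B, Finset.sum_mul]
    refine Finset.sum_congr rfl fun m _ ↦ ?_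
    rw [hsymm n m]; ring
  have hss : ∑ n ∈ Ico B N, ∑ m ∈ Ico B N, y n * y m * M n m
      = ∑ n ∈ Ico B N, ∑ m ∈ Ico B N, y n * M n m * y m :=
    Finset.sum_congr rfl fun n _ ↦ Finset.sum_congr rfl fun m _ ↦ by ring
  rw [hBB, hBs, hsB, hss]
  ring

/-- **Soundness of the two-level format-C certificate, for every truncation.**  Let `M : ℕ → ℕ → ℝ` be symmetric,
`B` the block size, `d̂ : ℕ → ℝ` positive on the far modes `m ≥ B`, `U` a real `B × B` matrix.  Suppose
(L-C3a) on every far truncation `Σ_{B≤n<N} d̂_n y_n² ≤ Σ_{B≤n,m<N} y_n M(n,m) y_m`;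
(L-C3b) for every far truncation and block vector `x`, `Σ_{B≤m<N} c_m(x)²/d̂_m ≤ xᵀUx`;
(P) `((Matrix.of fun i j : Fin B ↦ M i j) − U).PosSemidef`.
Then `0 ≤ Σ_{n,m<N} y_n y_m M(n,m)` for EVERY `N` and every real `y`. -/
theorem sum_range_mul_mul_nonneg_of_certificate (M : ℕ → ℕ → ℝ) (hsymm : ∀ n m, M n m = M m n) (B : ℕ)
    (dhat : ℕ → ℝ) (U : Matrix (Fin B) (Fin B) ℝ) (hd : ∀ m, B ≤ m → 0 < dhat m)
    (hfar : ∀ (N : ℕ) (y : ℕ → ℝ),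
      ∑ n ∈ Ico B N, dhat n * y n ^ 2 ≤ ∑ n ∈ Ico B N, ∑ m ∈ Ico B N, y n * M n m * y m)
    (hU : ∀ (N : ℕ) (x : Fin B → ℝ),
      ∑ m ∈ Ico B N, (∑ i : Fin B, M i m * x i) ^ 2 / dhat m ≤ x ⬝ᵥ U *ᵥ x)
    (hS : ((Matrix.of fun i j : Fin B ↦ M i j) - U).PosSemidef) (N : ℕ) (y : ℕ → ℝ) :
    0 ≤ ∑ n ∈ range N, ∑ m ∈ range N, y n * y m * M n m := by
  -- Reduce to `B ≤ N` by extending `y` by zero.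
  wlog hBN : B ≤ N generalizing N y
  · have hNB : N ≤ B := le_of_not_ge hBN
    set y' : ℕ → ℝ := fun n ↦ if n < N then y n else 0 with hy'
    have key := this B y' le_rfl
    have e : ∑ n ∈ range B, ∑ m ∈ range B, y' n * y' m * M n m
        = ∑ n ∈ range N, ∑ m ∈ range N, y n * y m * M n m := by
      have hsub : range N ⊆ range B := Finset.range_subset_range.mpr hNB
      rw [← Finset.sum_subset hsub]
      · refine Finset.sum_congr rfl fun n hn ↦ ?_
        have hn' : n < N := Finset.mem_range.mp hn
        rw [← Finset.sum_subset hsub]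
        · refine Finset.sum_congr rfl fun m hm ↦ ?_
          have hm' : m < N := Finset.mem_range.mp hm
          simp only [hy', if_pos hn', if_pos hm']
        · intro m _ hm
          have hm' : ¬ m < N := fun h ↦ hm (Finset.mem_range.mpr h)
          simp only [hy', if_neg hm', mul_zero, zero_mul]
      · intro n _ hn
        have hn' : ¬ n < N := fun h ↦ hn (Finset.mem_range.mpr h)
        refine Finset.sum_eq_zero fun m _ ↦ ?_
        simp only [hy', if_neg hn', zero_mul]
    rw [← e]
    exact key
  -- Main case `B ≤ N`: bookkeeping identity + diagonal Schur step on the far index type `↥(Ico B N)`.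
  rw [sum_range_mul_mul_eq_block_add_coupling_add_far M hsymm hBN y]
  set x : Fin B → ℝ := fun i ↦ y i with hx
  set s : Finset ℕ := Ico B N with hs
  have hmem : ∀ m : s, B ≤ (m : ℕ) := fun m ↦ (Finset.mem_Ico.mp m.2).1
  have step := schurStepDiag_posSemidef (κ := s) ((Matrix.of fun i j : Fin B ↦ M i j)) U x
    (fun m ↦ (∑ i : Fin B, M i m * x i)) (fun m ↦ dhat m) (fun m ↦ y m)
    (fun m ↦ hd m (hmem m)) ?_ hS
  · -- convert the `Fintype ↥s` sums back to `Finset` sums and add the far bound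
    have e1 : ∑ m : s, (∑ i : Fin B, M i m * x i) * y m = ∑ m ∈ s, (∑ i : Fin B, M i m * x i) * y m :=
      Finset.sum_coe_sort s (fun m ↦ (∑ i : Fin B, M i m * x i) * y m)
    have e2 : ∑ m : s, dhat m * y m ^ 2 = ∑ m ∈ s, dhat m * y m ^ 2 :=
      Finset.sum_coe_sort s (fun m ↦ dhat m * y m ^ 2)
    rw [e1, e2] at step
    linarith [hfar N y, step]
  · have e3 : ∑ m : s, (∑ i : Fin B, M i m * x i) ^ 2 / dhat m = ∑ m ∈ s, (∑ i : Fin B, M i m * x i) ^ 2 / dhat m :=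
      Finset.sum_coe_sort s (fun m ↦ (∑ i : Fin B, M i m * x i) ^ 2 / dhat m)
    rw [e3]
    exact hU N x

/-- **Soundness with a split majorant** (how L-C3b is met in practice): exact columns on `[B, B₃)` majorised by `U₁`
(for every truncation below `B₃`) and the structured tail on `[B₃, N)` majorised by `U₂` (for every `N`;
`WeilFormatC.tailMajorant`), with the kernel certificate on `(Matrix.of fun i j : Fin B ↦ M i j) − (U₁ + U₂)`. -/
theorem sum_range_mul_mul_nonneg_of_certificate_split (M : ℕ → ℕ → ℝ) (hsymm : ∀ n m, M n m = M m n)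
    (B B₃ : ℕ) (hB : B ≤ B₃) (dhat : ℕ → ℝ) (U₁ U₂ : Matrix (Fin B) (Fin B) ℝ)
    (hd : ∀ m, B ≤ m → 0 < dhat m)
    (hfar : ∀ (N : ℕ) (y : ℕ → ℝ),
      ∑ n ∈ Ico B N, dhat n * y n ^ 2 ≤ ∑ n ∈ Ico B N, ∑ m ∈ Ico B N, y n * M n m * y m)
    (hU₁ : ∀ x : Fin B → ℝ, ∑ m ∈ Ico B B₃, (∑ i : Fin B, M i m * x i) ^ 2 / dhat m ≤ x ⬝ᵥ U₁ *ᵥ x)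
    (hU₂ : ∀ (N : ℕ) (x : Fin B → ℝ),
      ∑ m ∈ Ico B₃ N, (∑ i : Fin B, M i m * x i) ^ 2 / dhat m ≤ x ⬝ᵥ U₂ *ᵥ x)
    (hS : ((Matrix.of fun i j : Fin B ↦ M i j) - (U₁ + U₂)).PosSemidef) (N : ℕ) (y : ℕ → ℝ) :
    0 ≤ ∑ n ∈ range N, ∑ m ∈ range N, y n * y m * M n m := by
  refine sum_range_mul_mul_nonneg_of_certificate M hsymm B dhat (U₁ + U₂) hd hfar (fun N' x ↦ ?_) hS N y
  -- `U₂ ⪰ 0` as a consequence of `hU₂` at the empty truncation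
  have hU₂nn : 0 ≤ x ⬝ᵥ U₂ *ᵥ x := by
    have h := hU₂ B₃ x
    simpa using h
  have hU₁nn : ∀ N'', N'' ≤ B₃ →
      ∑ m ∈ Ico B N'', (∑ i : Fin B, M i m * x i) ^ 2 / dhat m ≤ x ⬝ᵥ U₁ *ᵥ x := by
    intro N'' hN''
    refine le_trans ?_ (hU₁ x)
    refine Finset.sum_le_sum_of_subset_of_nonneg (Finset.Ico_subset_Ico_right hN'') fun m hm _ ↦ ?_
    exact div_nonneg (sq_nonneg _) (hd m (Finset.mem_Ico.mp hm).1).le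
  by_cases hN' : N' ≤ B₃
  · rw [add_mulVec, dotProduct_add]
    linarith [hU₁nn N' hN', hU₂nn]
  · have hB₃N' : B₃ ≤ N' := le_of_not_ge hN'
    have hsplit : Ico B N' = Ico B B₃ ∪ Ico B₃ N' :=
      (Finset.Ico_union_Ico_eq_Ico hB hB₃N').symm
    rw [hsplit]
    exact sum_sq_div_le_of_split U₁ U₂ x (fun m ↦ (∑ i : Fin B, M i m * x i)) dhat (Ico B B₃) (Ico B₃ N')
      (Finset.Ico_disjoint_Ico_consecutive B B₃ N') (hU₁ x) (hU₂ N' x)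


/-! ## Variants of the kernel hypothesis (appended, rh-explicit-weil-10 gen3)

The block certificate reaches the kernel as a statement about REAL QUADRATIC FORMS, not as `Matrix.PosSemidef`
(which also asks hermitian-ness of `U`): weil-2's `PsdDyadic.psd_of_checkPsdMid`
(`Literature/NumberTheory/LFunctions/PsdDyadicCertificate.lean`) delivers `∀ α, 0 ≤ Σ_i Σ_j α_i α_j S_{ij}` for any
real `S` entrywise enclosed by the checked dyadic data.  The two variants below take the certificate in that shape. -/

/-- **Soundness, form-comparison shape.**  As `sum_range_mul_mul_nonneg_of_certificate`, with the kernel step given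
as `xᵀUx ≤ xᵀGx` for every real block vector (`G = M|_{Fin B}`; no symmetry of `U` needed). -/
theorem sum_range_mul_mul_nonneg_of_certificate_le (M : ℕ → ℕ → ℝ) (hsymm : ∀ n m, M n m = M m n) (B : ℕ)
    (dhat : ℕ → ℝ) (U : Matrix (Fin B) (Fin B) ℝ) (hd : ∀ m, B ≤ m → 0 < dhat m)
    (hfar : ∀ (N : ℕ) (y : ℕ → ℝ),
      ∑ n ∈ Ico B N, dhat n * y n ^ 2 ≤ ∑ n ∈ Ico B N, ∑ m ∈ Ico B N, y n * M n m * y m)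
    (hU : ∀ (N : ℕ) (x : Fin B → ℝ),
      ∑ m ∈ Ico B N, (∑ i : Fin B, M i m * x i) ^ 2 / dhat m ≤ x ⬝ᵥ U *ᵥ x)
    (hS : ∀ x : Fin B → ℝ, x ⬝ᵥ U *ᵥ x ≤ x ⬝ᵥ (Matrix.of fun i j : Fin B ↦ M i j) *ᵥ x)
    (N : ℕ) (y : ℕ → ℝ) :
    0 ≤ ∑ n ∈ range N, ∑ m ∈ range N, y n * y m * M n m := by
  -- Reduce to `B ≤ N` by extending `y` by zero.
  wlog hBN : B ≤ N generalizing N y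
  · have hNB : N ≤ B := le_of_not_ge hBN
    set y' : ℕ → ℝ := fun n ↦ if n < N then y n else 0 with hy'
    have key := this B y' le_rfl
    have e : ∑ n ∈ range B, ∑ m ∈ range B, y' n * y' m * M n m
        = ∑ n ∈ range N, ∑ m ∈ range N, y n * y m * M n m := by
      have hsub : range N ⊆ range B := Finset.range_subset_range.mpr hNB
      rw [← Finset.sum_subset hsub]
      · refine Finset.sum_congr rfl fun n hn ↦ ?_
        have hn' : n < N := Finset.mem_range.mp hn
        rw [← Finset.sum_subset hsub]
        · refine Finset.sum_congr rfl fun m hm ↦ ?_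
          have hm' : m < N := Finset.mem_range.mp hm
          simp only [hy', if_pos hn', if_pos hm']
        · intro m _ hm
          have hm' : ¬ m < N := fun h ↦ hm (Finset.mem_range.mpr h)
          simp only [hy', if_neg hm', mul_zero, zero_mul]
      · intro n _ hn
        have hn' : ¬ n < N := fun h ↦ hn (Finset.mem_range.mpr h)
        refine Finset.sum_eq_zero fun m _ ↦ ?_
        simp only [hy', if_neg hn', zero_mul]
    rw [← e]
    exact key
  rw [sum_range_mul_mul_eq_block_add_coupling_add_far M hsymm hBN y]
  set x : Fin B → ℝ := fun i ↦ y i with hx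
  set s : Finset ℕ := Ico B N with hs
  have hmem : ∀ m : s, B ≤ (m : ℕ) := fun m ↦ (Finset.mem_Ico.mp m.2).1
  have step := schurStepDiag_nonneg (κ := s) (Matrix.of fun i j : Fin B ↦ M i j) U x
    (fun m ↦ ∑ i : Fin B, M i m * x i) (fun m ↦ dhat m) (fun m ↦ y m)
    (fun m ↦ hd m (hmem m)) ?_ (hS x)
  · have e1 : ∑ m : s, (∑ i : Fin B, M i m * x i) * y m = ∑ m ∈ s, (∑ i : Fin B, M i m * x i) * y m :=
      Finset.sum_coe_sort s (fun m ↦ (∑ i : Fin B, M i m * x i) * y m)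
    have e2 : ∑ m : s, dhat m * y m ^ 2 = ∑ m ∈ s, dhat m * y m ^ 2 :=
      Finset.sum_coe_sort s (fun m ↦ dhat m * y m ^ 2)
    rw [e1, e2] at step
    linarith [hfar N y, step]
  · have e3 : ∑ m : s, (∑ i : Fin B, M i m * x i) ^ 2 / dhat m = ∑ m ∈ s, (∑ i : Fin B, M i m * x i) ^ 2 / dhat m :=
      Finset.sum_coe_sort s (fun m ↦ (∑ i : Fin B, M i m * x i) ^ 2 / dhat m)
    rw [e3]
    exact hU N x

/-- The block forms written as double sums: `xᵀUx = Σ_i Σ_j x_i x_j U_{ij}` and `xᵀGx = Σ_i Σ_j x_i x_j M(i,j)`. -/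
theorem dotProduct_mulVec_eq_sum_sum {B : ℕ} (U : Matrix (Fin B) (Fin B) ℝ) (x : Fin B → ℝ) :
    x ⬝ᵥ U *ᵥ x = ∑ i, ∑ j, x i * x j * U i j := by
  simp only [dotProduct, mulVec, Finset.mul_sum]
  refine Finset.sum_congr rfl fun i _ ↦ Finset.sum_congr rfl fun j _ ↦ by ring

/-- **Soundness, double-sum shape** — the kernel certificate exactly as `PsdDyadic.psd_of_checkPsdMid` delivers it:
`∀ x, 0 ≤ Σ_i Σ_j x_i x_j (M(i,j) − U_{ij})` for the real matrix `S = M|_{Fin B} − U` enclosed by the checked data. -/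
theorem sum_range_mul_mul_nonneg_of_certificate_sum (M : ℕ → ℕ → ℝ) (hsymm : ∀ n m, M n m = M m n) (B : ℕ)
    (dhat : ℕ → ℝ) (U : Matrix (Fin B) (Fin B) ℝ) (hd : ∀ m, B ≤ m → 0 < dhat m)
    (hfar : ∀ (N : ℕ) (y : ℕ → ℝ),
      ∑ n ∈ Ico B N, dhat n * y n ^ 2 ≤ ∑ n ∈ Ico B N, ∑ m ∈ Ico B N, y n * M n m * y m)
    (hU : ∀ (N : ℕ) (x : Fin B → ℝ),
      ∑ m ∈ Ico B N, (∑ i : Fin B, M i m * x i) ^ 2 / dhat m ≤ x ⬝ᵥ U *ᵥ x)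
    (hS : ∀ x : Fin B → ℝ, 0 ≤ ∑ i, ∑ j, x i * x j * (M i j - U i j))
    (N : ℕ) (y : ℕ → ℝ) :
    0 ≤ ∑ n ∈ range N, ∑ m ∈ range N, y n * y m * M n m := by
  refine sum_range_mul_mul_nonneg_of_certificate_le M hsymm B dhat U hd hfar hU (fun x ↦ ?_) N y
  rw [dotProduct_mulVec_eq_sum_sum, dotProduct_mulVec_eq_sum_sum]
  have h := hS x
  have e : ∑ i, ∑ j, x i * x j * (M i j - U i j)
      = (∑ i, ∑ j, x i * x j * (Matrix.of fun i j : Fin B ↦ M i j) i j) - ∑ i, ∑ j, x i * x j * U i j := by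
    rw [← Finset.sum_sub_distrib]
    refine Finset.sum_congr rfl fun i _ ↦ ?_
    rw [← Finset.sum_sub_distrib]
    refine Finset.sum_congr rfl fun j _ ↦ ?_
    rw [Matrix.of_apply]; ring
  linarith [e ▸ h]

/-- **Soundness, double-sum shape with a split majorant** `U = U₁ + U₂` (exact columns on `[B, B₃)`, structured
tail on `[B₃, N)` for every `N`), kernel certificate `∀ x, 0 ≤ Σ_i Σ_j x_i x_j (M(i,j) − U₁_{ij} − U₂_{ij})`. -/
theorem sum_range_mul_mul_nonneg_of_certificate_sum_split (M : ℕ → ℕ → ℝ) (hsymm : ∀ n m, M n m = M m n)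
    (B B₃ : ℕ) (hB : B ≤ B₃) (dhat : ℕ → ℝ) (U₁ U₂ : Matrix (Fin B) (Fin B) ℝ)
    (hd : ∀ m, B ≤ m → 0 < dhat m)
    (hfar : ∀ (N : ℕ) (y : ℕ → ℝ),
      ∑ n ∈ Ico B N, dhat n * y n ^ 2 ≤ ∑ n ∈ Ico B N, ∑ m ∈ Ico B N, y n * M n m * y m)
    (hU₁ : ∀ x : Fin B → ℝ, ∑ m ∈ Ico B B₃, (∑ i : Fin B, M i m * x i) ^ 2 / dhat m ≤ x ⬝ᵥ U₁ *ᵥ x)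
    (hU₂ : ∀ (N : ℕ) (x : Fin B → ℝ),
      ∑ m ∈ Ico B₃ N, (∑ i : Fin B, M i m * x i) ^ 2 / dhat m ≤ x ⬝ᵥ U₂ *ᵥ x)
    (hS : ∀ x : Fin B → ℝ, 0 ≤ ∑ i, ∑ j, x i * x j * (M i j - U₁ i j - U₂ i j))
    (N : ℕ) (y : ℕ → ℝ) :
    0 ≤ ∑ n ∈ range N, ∑ m ∈ range N, y n * y m * M n m := by
  refine sum_range_mul_mul_nonneg_of_certificate_sum M hsymm B dhat (U₁ + U₂) hd hfar (fun N' x ↦ ?_)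
    (fun x ↦ ?_) N y
  · have hU₂nn : 0 ≤ x ⬝ᵥ U₂ *ᵥ x := by simpa using hU₂ B₃ x
    have hU₁nn : ∀ N'', N'' ≤ B₃ →
        ∑ m ∈ Ico B N'', (∑ i : Fin B, M i m * x i) ^ 2 / dhat m ≤ x ⬝ᵥ U₁ *ᵥ x := by
      intro N'' hN''
      refine le_trans ?_ (hU₁ x)
      refine Finset.sum_le_sum_of_subset_of_nonneg (Finset.Ico_subset_Ico_right hN'') fun m hm _ ↦ ?_
      exact div_nonneg (sq_nonneg _) (hd m (Finset.mem_Ico.mp hm).1).le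
    by_cases hN' : N' ≤ B₃
    · rw [add_mulVec, dotProduct_add]
      linarith [hU₁nn N' hN', hU₂nn]
    · have hB₃N' : B₃ ≤ N' := le_of_not_ge hN'
      rw [(Finset.Ico_union_Ico_eq_Ico hB hB₃N').symm]
      exact sum_sq_div_le_of_split U₁ U₂ x (fun m ↦ ∑ i : Fin B, M i m * x i) dhat (Ico B B₃) (Ico B₃ N')
        (Finset.Ico_disjoint_Ico_consecutive B B₃ N') (hU₁ x) (hU₂ N' x)
  · refine le_of_le_of_eq (hS x) (Finset.sum_congr rfl fun i _ ↦ Finset.sum_congr rfl fun j _ ↦ ?_)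
    rw [Matrix.add_apply]; ring

end Summit.RiemannHypothesis.RiemannHypothesis.Theorems.WeilFormatC
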